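/-
Copyright (c) 2026. All rights reserved.
Released under Apache 2.0 license as described in the file LICENSE.
-/
import Literature.MathematicalPhysics.QuantumLattice.HartreeFockQuasiFreeCertificateKernelData
import Literature.MathematicalPhysics.QuantumLattice.SquareTorusDiagonalTube
import HarnessLib

/-!
# Kernel-checkable quasi-free certificates: soundness of the checks

Topic `MathematicalPhysics/QuantumLattice`, family `hubbard`; the second half of the device begun
in `HartreeFockQuasiFreeCertificateKernelData.lean`. For an integer certificate `c : QFK.Cert M r`
we build the tree-side objects of `HartreeFock.energyDensityTT'_le_qfPlane` — the support
`box r = {R : |R i| ≤ r}`, the pre-shrink kernels `c.γt σ R` (entries `g/2^P` read from the packed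
table through the site dictionary `RectTorusSite M ≃ Fin (M 0) × Fin (M 1)`), the defect bounds
`c.cfun σ T = C σ T / 2^{2P}` and the shrink reals `a_σ = c.A σ`, `b_σ = c.B σ` — and prove that the
Boolean checks discharge every hypothesis of that theorem:

* `checkSymm` ⟹ `γ̃_σ(-R) = γ̃_σ(R)ᴴ` (`γt_neg`);
* `defectKernel (box r) (γt σ) T` has the entries `c.dEntry σ a b / 2^{2P}` (`defectKernel_γt_apply`,
  `qEntry_eq_dEntry`), so `rowCheck σ a` ⟹ `‖d_σ(T)‖_F ≤ cfun σ T` on the rows `a ≥ 2r`, and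
  `d_σ(-T) = d_σ(T)ᴴ` (`defectKernel_neg`, any symmetric kernel) covers the rows `a < 2r`;
* `Σ_{T ∈ defectSupport} cfun σ T ≤ Δ_σ/2^{2P}`, whence the three shrink inequalities hold for
  `a_σ = 2^{2P}/(2^{2P}+2Δ_σ)`, `b_σ = a_σΔ_σ/2^{2P}` IDENTICALLY (`shrink_ineq`);
* `checkNumbers` ⟹ the filling and the three cell numbers of the shrunk kernel are the claimed
  rationals (`trace_shrink_eq`, `qfCellEnergy_one_zero_eq`, `qfCellDiag_eq`, `qfCellEnergy_zero_one_eq`).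

MAIN THEOREM `energyDensityTT'_le_plane_of_checks`: if `checkBasic`, `checkSymm`, `checkNumbers`
hold and `rowCheck σ a` holds for every `σ` and every `a ≥ 2r`, then for all real `t, t'` and all
`U ≥ 0`, `e(t, t', U; c.n) ≤ t·c.K - t'·c.Kd + U·c.D` — an UNCONDITIONAL cap plane from data the
kernel has checked (first consumers: the antiferromagnetic Hartree–Fock caps at half filling,
`Certificates/HubbardSquare_afhfCaps_halfFilling.lean`). Everything is proved; no named facts.

## References

* V. Bach, E. H. Lieb, J. P. Solovej, J. Stat. Phys. 76 (1994) 3, eqs. (2c.4), (2c.8), (2c.36). [BachLiebSolovej1994]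
* E. H. Lieb, PRL 46 (1981) 457 (variational principle). [Lieb1981]
* A. Neumaier, Acta Numerica 13 (2004), §11. [Neumaier2004CompleteSearch]
-/

noncomputable section

namespace Literature.MathematicalPhysics.QuantumLattice

namespace HartreeFock

namespace QFK

open Matrix Finset Literature.Probability.LatticeModels HeisenbergTL
open scoped ComplexConjugate ComplexOrder

variable {M : Fin 2 → ℕ} [∀ i, NeZero (M i)] {r : ℕ}

/-! ### §1 The cell sites as pairs of `Fin` coordinates -/

/-- The dictionary `RectTorusSite M → Fin (M 0) × Fin (M 1)`. [folklore] -/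
def eM (p : RectTorusSite M) : Site M :=
  ((ZMod.finEquiv (M 0)).symm (p 0), (ZMod.finEquiv (M 1)).symm (p 1))

/-- Its inverse. [folklore] -/
def eMinv (x : Site M) : RectTorusSite M :=
  Fin.cons (α := fun i : Fin 2 => ZMod (M i)) (ZMod.finEquiv (M 0) x.1)
    (Fin.cons (α := fun i : Fin 1 => ZMod (M i.succ)) (ZMod.finEquiv (M 1) x.2) finZeroElim)

/-- `eMinv x 0`. [folklore] -/
@[simp] private theorem eMinv_zero (x : Site M) : eMinv x 0 = ZMod.finEquiv (M 0) x.1 := rfl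

/-- `eMinv x 1`. [folklore] -/
@[simp] private theorem eMinv_one (x : Site M) : eMinv x 1 = ZMod.finEquiv (M 1) x.2 := rfl

/-- **The site dictionary** `RectTorusSite M ≃ Fin (M 0) × Fin (M 1)`. [folklore] -/
def siteEquiv : RectTorusSite M ≃ Site M where
  toFun := eM
  invFun := eMinv
  left_inv p := by
    funext i
    refine Fin.cases ?_ (fun j => ?_) i
    · simp [eM]
    · refine Fin.cases ?_ (fun k => k.elim0) j
      show eMinv (eM p) 1 = p 1
      simp [eM]
  right_inv x := by
    refine Prod.ext ?_ ?_ <;> simp [eM]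

/-- `siteEquiv p = eM p`. [folklore] -/
@[simp] private theorem siteEquiv_apply (p : RectTorusSite M) : siteEquiv p = eM p := rfl

/-- `siteEquiv.symm x = eMinv x`. [folklore] -/
@[simp] private theorem siteEquiv_symm_apply (x : Site M) : (siteEquiv (M := M)).symm x = eMinv x := rfl

/-- Sums over the cell through the dictionary. [folklore] -/
private theorem sum_site {α : Type*} [AddCommMonoid α] (f : RectTorusSite M → α) :
    ∑ p, f p = ∑ x : Site M, f (eMinv x) :=
  Fintype.sum_equiv siteEquiv f (fun x => f (eMinv x)) fun p => by
    rw [← siteEquiv_symm_apply, Equiv.symm_apply_apply]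

/-- `eM` is injective. [folklore] -/
private theorem eM_injective : Function.Injective (eM (M := M)) := siteEquiv.injective

/-- `|cell| = M 0 · M 1`. [folklore] -/
private theorem card_site : Fintype.card (RectTorusSite M) = M 0 * M 1 := by
  rw [Fintype.card_congr siteEquiv, Fintype.card_prod, Fintype.card_fin, Fintype.card_fin]

/-- `p + e₀` in coordinates. [folklore] -/
private theorem eM_add_single_zero (p : RectTorusSite M) : eM (p + Pi.single 0 1) = wrap₀ (eM p) := by
  refine Prod.ext ?_ ?_
  · simp [eM, wrap₀, map_add]
  · simp [eM, wrap₀]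

/-- `p + e₁` in coordinates. [folklore] -/
private theorem eM_add_single_one (p : RectTorusSite M) : eM (p + Pi.single 1 1) = wrap₁ (eM p) := by
  refine Prod.ext ?_ ?_
  · simp [eM, wrap₁]
  · simp [eM, wrap₁, map_add]

/-- `p + e₀ + e₁` in coordinates. [folklore] -/
private theorem eM_add_single_zero_one (p : RectTorusSite M) :
    eM (p + Pi.single 0 1 + Pi.single 1 1) = wrap₁ (wrap₀ (eM p)) := by
  rw [eM_add_single_one, eM_add_single_zero]

/-- The value of the coordinate `0`. [folklore] -/
private theorem val_apply_zero (p : RectTorusSite M) : (p 0).val = (eM p).1.val := by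
  simp [eM, val_finEquiv_symm]

/-- The value of the coordinate `1`. [folklore] -/
private theorem val_apply_one (p : RectTorusSite M) : (p 1).val = (eM p).2.val := by
  simp [eM, val_finEquiv_symm]

/-- The face shift of the bond `p → p + e₀` in coordinates: `(fs₀, 0)`. [folklore] -/
private theorem faceShift_zero_apply (p : RectTorusSite M) :
    faceShift M 0 p 0 = fs₀ (eM p) ∧ faceShift M 0 p 1 = 0 := by
  unfold faceShift fs₀
  rw [val_apply_zero]
  split_ifs <;> simp

/-- The face shift of the bond `p → p + e₁` in coordinates: `(0, fs₁)`. [folklore] -/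
private theorem faceShift_one_apply (p : RectTorusSite M) :
    faceShift M 1 p 0 = 0 ∧ faceShift M 1 p 1 = fs₁ (eM p) := by
  unfold faceShift fs₁
  rw [val_apply_one]
  split_ifs <;> simp

/-! ### §2 The box support -/

/-- The superlattice vector with table indices `(u, v)`: `(u - r, v - r)`. [folklore] -/
def ivec (r : ℕ) (uv : Fin (2 * r + 1) × Fin (2 * r + 1)) : Fin 2 → ℤ :=
  ![(uv.1 : ℤ) - r, (uv.2 : ℤ) - r]

omit [∀ i, NeZero (M i)] in
/-- `ivec` is injective. [folklore] -/
private theorem ivec_injective (r : ℕ) : Function.Injective (ivec r) := by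
  intro a b h
  have h0 := congrFun h 0
  have h1 := congrFun h 1
  simp only [ivec, Matrix.cons_val_zero, Matrix.cons_val_one] at h0 h1
  exact Prod.ext (Fin.ext (by omega)) (Fin.ext (by omega))

/-- **The support** `box r = {R : |R i| ≤ r}` as the image of the table indices. [folklore] -/
def box (r : ℕ) : Finset (Fin 2 → ℤ) := Finset.univ.image (ivec r)

omit [∀ i, NeZero (M i)] in
/-- Membership in the box by coordinates. [folklore] -/
private theorem mem_box {R : Fin 2 → ℤ} :
    R ∈ box r ↔ (-(r : ℤ) ≤ R 0 ∧ R 0 ≤ r) ∧ (-(r : ℤ) ≤ R 1 ∧ R 1 ≤ r) := by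
  constructor
  · intro h
    obtain ⟨uv, -, rfl⟩ := Finset.mem_image.1 h
    simp only [ivec, Matrix.cons_val_zero, Matrix.cons_val_one]
    omega
  · intro h
    refine Finset.mem_image.2 ⟨(⟨(R 0 + r).toNat, by omega⟩, ⟨(R 1 + r).toNat, by omega⟩),
      Finset.mem_univ _, ?_⟩
    funext i
    fin_cases i
    · simp only [Fin.zero_eta, ivec, Matrix.cons_val_zero]; omega
    · simp only [Fin.mk_one, ivec, Matrix.cons_val_one, Matrix.cons_val_zero]; omega

omit [∀ i, NeZero (M i)] in
/-- Sums over the box are sums over the table indices. [folklore] -/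
private theorem sum_box {α : Type*} [AddCommMonoid α] (f : (Fin 2 → ℤ) → α) :
    ∑ R ∈ box r, f R = ∑ uv : Fin (2 * r + 1) × Fin (2 * r + 1), f (ivec r uv) := by
  rw [box, Finset.sum_image fun a _ b _ h => ivec_injective r h]

omit [∀ i, NeZero (M i)] in
/-- `0 ∈ box r`. [folklore] -/
private theorem zero_mem_box : (0 : Fin 2 → ℤ) ∈ box r := by
  rw [mem_box]; simp

omit [∀ i, NeZero (M i)] in
/-- The box is symmetric. [folklore] -/
private theorem neg_mem_box {R : Fin 2 → ℤ} (h : R ∈ box r) : -R ∈ box r := by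
  rw [mem_box] at h ⊢; simp only [Pi.neg_apply]; omega

omit [∀ i, NeZero (M i)] in
/-- The box has radius `r`. [folklore] -/
private theorem abs_le_of_mem_box {R : Fin 2 → ℤ} (h : R ∈ box r) (i : Fin 2) : |R i| ≤ ((r : ℕ) : ℤ) := by
  rw [mem_box] at h
  fin_cases i
  · show |R 0| ≤ (r : ℤ)
    exact abs_le.2 ⟨h.1.1, h.1.2⟩
  · show |R 1| ≤ (r : ℤ)
    exact abs_le.2 ⟨h.2.1, h.2.2⟩

omit [∀ i, NeZero (M i)] in
/-- The defect support `S ∪ (S + S)` of the box lies in the box of radius `2r`. [folklore] -/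
private theorem coord_of_mem_defectSupport {T : Fin 2 → ℤ} (h : T ∈ defectSupport (box r)) :
    (-(2 * r : ℤ) ≤ T 0 ∧ T 0 ≤ 2 * r) ∧ (-(2 * r : ℤ) ≤ T 1 ∧ T 1 ≤ 2 * r) := by
  rcases Finset.mem_union.1 h with h | h
  · have := mem_box.1 h; omega
  · obtain ⟨x, hx, rfl⟩ := Finset.mem_image.1 h
    obtain ⟨h1, h2⟩ := Finset.mem_product.1 hx
    have h1 := mem_box.1 h1; have h2 := mem_box.1 h2
    simp only [Pi.add_apply]
    omega

/-! ### §3 The pre-shrink kernels -/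

variable (c : Cert M r)

/-- **The pre-shrink kernel** `γ̃_σ(R)` of an integer certificate: entries `g_σ(R)[p,q]/2^P` read
through the site dictionary, zero outside the box. [cite: BachLiebSolovej1994, eq. (2c.4)] -/
def Cert.γt (σ : Fin 2) (R : Fin 2 → ℤ) : Matrix (RectTorusSite M) (RectTorusSite M) ℂ :=
  Matrix.of fun p q => ((c.gZ σ (R 0) (R 1) (eM p) (eM q) : ℤ) : ℂ) / (2 : ℂ) ^ c.P

/-- Entries of `γt`. [cite: BachLiebSolovej1994, eq. (2c.4)] -/
theorem γt_apply (σ : Fin 2) (R : Fin 2 → ℤ) (p q : RectTorusSite M) :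
    c.γt σ R p q = ((c.gZ σ (R 0) (R 1) (eM p) (eM q) : ℤ) : ℂ) / (2 : ℂ) ^ c.P := rfl

omit [∀ i, NeZero (M i)] in
/-- `gZ` vanishes outside the box. [cite: BachLiebSolovej1994, eq. (2c.4)] -/
theorem gZ_eq_zero_of_not_mem {σ : Fin 2} {R : Fin 2 → ℤ} (hR : R ∉ box r) (p q : Site M) :
    c.gZ σ (R 0) (R 1) p q = 0 := by
  rw [mem_box] at hR
  unfold Cert.gZ
  rw [dif_neg]
  intro h; exact hR ⟨⟨h.1, h.2.1⟩, h.2.2.1, h.2.2.2⟩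

/-- `γt` vanishes outside the box. [cite: BachLiebSolovej1994, eq. (2c.4)] -/
theorem γt_eq_zero {σ : Fin 2} {R : Fin 2 → ℤ} (hR : R ∉ box r) : c.γt σ R = 0 := by
  ext p q
  rw [γt_apply, gZ_eq_zero_of_not_mem c hR, Int.cast_zero, zero_div, Matrix.zero_apply]

omit [∀ i, NeZero (M i)] in
/-- `checkSymm` gives `g_σ(-R) = g_σ(R)ᵀ` at integer vectors. [cite: BachLiebSolovej1994, eq. (2c.4)] -/
theorem gZ_neg (hS : c.checkSymm = true) (σ : Fin 2) (R₀ R₁ : ℤ) (p q : Site M) :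
    c.gZ σ (-R₀) (-R₁) p q = c.gZ σ R₀ R₁ q p := by
  rw [Cert.checkSymm, Bool.and_eq_true] at hS
  have hg := fun σ u v p q =>
    of_decide_eq_true (of_allSite (of_allSite (of_allFin (of_allFin (of_allFin hS.1 σ) u) v) p) q)
  unfold Cert.gZ
  by_cases h : -(r : ℤ) ≤ R₀ ∧ R₀ ≤ r ∧ -(r : ℤ) ≤ R₁ ∧ R₁ ≤ r
  · rw [dif_pos (by omega), dif_pos h, ← hg σ ⟨(R₀ + r).toNat, by omega⟩ ⟨(R₁ + r).toNat, by omega⟩ q p]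
    congr 1 <;> exact Fin.ext (by simp only; omega)
  · rw [dif_neg (by omega), dif_neg h]

/-- **`checkSymm` gives `γ̃_σ(-R) = γ̃_σ(R)ᴴ`.** [cite: BachLiebSolovej1994, eq. (2c.4)] -/
theorem γt_neg (hS : c.checkSymm = true) (σ : Fin 2) (R : Fin 2 → ℤ) :
    c.γt σ (-R) = (c.γt σ R)ᴴ := by
  ext p q
  rw [Matrix.conjTranspose_apply, γt_apply, γt_apply, Pi.neg_apply, Pi.neg_apply, gZ_neg c hS]
  simp

/-! ### §4 The defect kernel of `γt` -/

omit [∀ i, NeZero (M i)] in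
/-- The defect sum as a convolution: for a kernel vanishing off `S`,
`Σ_{(R,R') ∈ S², R+R'=T} γ R γ R' = Σ_{R ∈ S} γ R γ (T-R)`. [cite: BachLiebSolovej1994, eq. (2c.4)] -/
theorem sum_filter_add_eq {d : ℕ} {m : Type*} [Fintype m] (S : Finset (Fin d → ℤ))
    (γ : (Fin d → ℤ) → Matrix m m ℂ) (hγ : ∀ R ∉ S, γ R = 0) (T : Fin d → ℤ) :
    ∑ x ∈ (S ×ˢ S).filter (fun x => x.1 + x.2 = T), γ x.1 * γ x.2 = ∑ R ∈ S, γ R * γ (T - R) := by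
  rw [Finset.sum_filter, Finset.sum_product]
  refine Finset.sum_congr rfl fun R _ => ?_
  have h : ∀ R' ∈ S, (if R + R' = T then γ R * γ R' else 0) = if T - R = R' then γ R * γ R' else 0 := by
    intro R' _
    by_cases h1 : R + R' = T
    · rw [if_pos h1, if_pos (by rw [← h1]; abel)]
    · rw [if_neg h1, if_neg (fun h2 => h1 (by rw [← h2]; abel))]
  rw [Finset.sum_congr rfl h, Finset.sum_ite_eq]
  split_ifs with hmem
  · rfl
  · rw [hγ _ hmem, mul_zero]

omit [∀ i, NeZero (M i)] in
/-- The defect kernel of a kernel vanishing off `S` as a convolution. [cite: BachLiebSolovej1994, eq. (2c.4)] -/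
theorem defectKernel_eq_sub_sum {d : ℕ} {M' : Fin d → ℕ} [∀ i, NeZero (M' i)] (S : Finset (Fin d → ℤ))
    (γ : (Fin d → ℤ) → Matrix (RectTorusSite M') (RectTorusSite M') ℂ) (hγ : ∀ R ∉ S, γ R = 0)
    (T : Fin d → ℤ) : defectKernel S γ T = γ T - ∑ R ∈ S, γ R * γ (T - R) := by
  rw [defectKernel, sum_filter_add_eq S γ hγ]
  split_ifs with h
  · rfl
  · rw [hγ T h]

omit [∀ i, NeZero (M i)] in
/-- **The defect kernel of a symmetric kernel is Hermitian-symmetric under `T ↦ -T`**: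
`d(-T) = d(T)ᴴ` (`S = -S`, `γ(-R) = γ(R)ᴴ`; reindex the pairs `(R, R') ↦ (-R', -R)`).
[cite: BachLiebSolovej1994, eq. (2c.4)] -/
theorem defectKernel_neg {d : ℕ} {M' : Fin d → ℕ} [∀ i, NeZero (M' i)] (S : Finset (Fin d → ℤ))
    (hSneg : ∀ R ∈ S, -R ∈ S) (γ : (Fin d → ℤ) → Matrix (RectTorusSite M') (RectTorusSite M') ℂ)
    (hγ : ∀ R, γ (-R) = (γ R)ᴴ) (T : Fin d → ℤ) :
    defectKernel S γ (-T) = (defectKernel S γ T)ᴴ := by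
  have hiff : ∀ X : Fin d → ℤ, -X ∈ S ↔ X ∈ S :=
    fun X => ⟨fun h => by simpa using hSneg _ h, fun h => hSneg _ h⟩
  unfold defectKernel
  rw [Matrix.conjTranspose_sub]
  congr 1
  · by_cases hT : T ∈ S
    · rw [if_pos ((hiff T).2 hT), if_pos hT, hγ]
    · rw [if_neg (mt (hiff T).1 hT), if_neg hT, Matrix.conjTranspose_zero]
  · rw [Matrix.conjTranspose_sum]
    simp_rw [Matrix.conjTranspose_mul, ← hγ]
    symm
    refine Finset.sum_nbij' (fun x => (-x.2, -x.1)) (fun x => (-x.2, -x.1)) ?_ ?_ ?_ ?_ ?_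
    · intro x hx
      rw [Finset.mem_filter, Finset.mem_product] at hx ⊢
      exact ⟨⟨hSneg _ hx.1.2, hSneg _ hx.1.1⟩, by rw [← hx.2, neg_add, add_comm]⟩
    · intro x hx
      rw [Finset.mem_filter, Finset.mem_product] at hx ⊢
      exact ⟨⟨hSneg _ hx.1.2, hSneg _ hx.1.1⟩, by rw [← neg_neg T, ← hx.2, neg_add, add_comm]⟩
    · intro x _; simp
    · intro x _; simp
    · intro x _; rfl

omit [∀ i, NeZero (M i)] in
/-- The Frobenius norm is invariant under the conjugate transpose. [folklore] -/
private theorem frobSq_conjTranspose {m : Type*} [Fintype m] (A : Matrix m m ℂ) :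
    ∑ i, ∑ j, ‖Aᴴ i j‖ ^ 2 = ∑ i, ∑ j, ‖A i j‖ ^ 2 := by
  rw [Finset.sum_comm]
  simp [Matrix.conjTranspose_apply]

/-- **The rational mirror of a defect entry**: `γ̃(T)[p,q] - Σ_{R ∈ S} Σ_j γ̃(R)[p,j] γ̃(T-R)[j,q]` with
the entries `gZ/2^P`. [cite: BachLiebSolovej1994, eq. (2c.4)] -/
def Cert.qEntry (σ : Fin 2) (T₀ T₁ : ℤ) (p q : Site M) : ℚ :=
  (c.gZ σ T₀ T₁ p q : ℚ) / 2 ^ c.P -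
    ∑ uv : Fin (2 * r + 1) × Fin (2 * r + 1), ∑ j : Site M,
      (c.gZ σ ((uv.1 : ℤ) - r) ((uv.2 : ℤ) - r) p j : ℚ) / 2 ^ c.P *
        ((c.gZ σ (T₀ - ((uv.1 : ℤ) - r)) (T₁ - ((uv.2 : ℤ) - r)) j q : ℚ) / 2 ^ c.P)

/-- **The defect kernel of `γt` has the rational entries `qEntry`.** [cite: BachLiebSolovej1994, eq. (2c.4)] -/
theorem defectKernel_γt_apply (σ : Fin 2) (T : Fin 2 → ℤ) (p q : RectTorusSite M) :
    defectKernel (box r) (c.γt σ) T p q = ((c.qEntry σ (T 0) (T 1) (eM p) (eM q) : ℚ) : ℂ) := by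
  rw [defectKernel_eq_sub_sum (box r) (c.γt σ) (fun R hR => γt_eq_zero c hR), Matrix.sub_apply,
    Matrix.sum_apply, sum_box, γt_apply, Cert.qEntry]
  push_cast
  congr 1
  refine Finset.sum_congr rfl fun uv _ => ?_
  rw [Matrix.mul_apply, sum_site]
  refine Finset.sum_congr rfl fun j _ => ?_
  rw [γt_apply, γt_apply]
  have hj : eM (eMinv j) = j := siteEquiv.apply_symm_apply j
  simp only [ivec, Pi.sub_apply, Matrix.cons_val_zero, Matrix.cons_val_one, hj]

omit [∀ i, NeZero (M i)] in
/-- `gZ` at `(u - r, v - r)` is the table entry. [cite: BachLiebSolovej1994, eq. (2c.4)] -/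
theorem gZ_sub (σ : Fin 2) (u v : Fin (2 * r + 1)) (p q : Site M) :
    c.gZ σ ((u : ℤ) - r) ((v : ℤ) - r) p q = c.g σ u v p q := by
  unfold Cert.gZ
  rw [dif_pos (by omega)]
  congr 1 <;> exact Fin.ext (by simp)

omit [∀ i, NeZero (M i)] in
/-- `gZ` at `T = (a - 2r, b - 2r)`. [cite: BachLiebSolovej1994, eq. (2c.4)] -/
theorem gZ_center (σ : Fin 2) (a b : Fin (2 * (2 * r) + 1)) (p q : Site M) :
    c.gZ σ ((a : ℤ) - 2 * r) ((b : ℤ) - 2 * r) p q =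
      if h : r ≤ a.val ∧ a.val ≤ 3 * r ∧ r ≤ b.val ∧ b.val ≤ 3 * r then
        c.g σ ⟨a.val - r, by omega⟩ ⟨b.val - r, by omega⟩ p q else 0 := by
  unfold Cert.gZ
  by_cases h : r ≤ a.val ∧ a.val ≤ 3 * r ∧ r ≤ b.val ∧ b.val ≤ 3 * r
  · rw [dif_pos (by omega), dif_pos h]
    congr 1 <;> exact Fin.ext (by simp only; omega)
  · rw [dif_neg (by omega), dif_neg h]

omit [∀ i, NeZero (M i)] in
/-- `gZ` at `T - R`, `T = (a - 2r, b - 2r)`, `R = (u - r, v - r)`. [cite: BachLiebSolovej1994, eq. (2c.4)] -/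
theorem gZ_shift (σ : Fin 2) (a b : Fin (2 * (2 * r) + 1)) (u v : Fin (2 * r + 1)) (p q : Site M) :
    c.gZ σ ((a : ℤ) - 2 * r - ((u : ℤ) - r)) ((b : ℤ) - 2 * r - ((v : ℤ) - r)) p q =
      if h : u.val ≤ a.val ∧ a.val ≤ u.val + 2 * r ∧ v.val ≤ b.val ∧ b.val ≤ v.val + 2 * r then
        c.g σ ⟨a.val - u.val, by omega⟩ ⟨b.val - v.val, by omega⟩ p q else 0 := by
  unfold Cert.gZ
  by_cases h : u.val ≤ a.val ∧ a.val ≤ u.val + 2 * r ∧ v.val ≤ b.val ∧ b.val ≤ v.val + 2 * r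
  · rw [dif_pos (by omega), dif_pos h]
    congr 1 <;> exact Fin.ext (by simp only; omega)
  · rw [dif_neg (by omega), dif_neg h]

omit [∀ i, NeZero (M i)] in
/-- **The rational defect entry is the integer one, scaled**: `qEntry = dEntry / 2^{2P}`.
[cite: BachLiebSolovej1994, eq. (2c.4)] -/
theorem qEntry_eq_dEntry (σ : Fin 2) (a b : Fin (2 * (2 * r) + 1)) (p q : Site M) :
    c.qEntry σ ((a : ℤ) - 2 * r) ((b : ℤ) - 2 * r) p q = (c.dEntry σ a b p q : ℚ) / 2 ^ (2 * c.P) := by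
  have h2 : (2 : ℚ) ^ (2 * c.P) = 2 ^ c.P * 2 ^ c.P := by rw [two_mul, pow_add]
  unfold Cert.qEntry Cert.dEntry
  rw [gZ_center, sumFin_eq]
  simp_rw [sumFin_eq, sumSite_eq, gZ_sub, gZ_shift]
  rw [Fintype.sum_prod_type, Int.cast_sub, sub_div, Int.cast_sum, Finset.sum_div]
  congr 1
  · split_ifs
    · push_cast; rw [h2]; field_simp
    · simp
  · refine Finset.sum_congr rfl fun u _ => ?_
    rw [Int.cast_sum, Finset.sum_div]
    refine Finset.sum_congr rfl fun v _ => ?_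
    split_ifs with h
    · rw [Int.cast_sum, Finset.sum_div]
      refine Finset.sum_congr rfl fun j _ => ?_
      push_cast
      rw [h2]
      ring
    · simp

/-- **The Frobenius square of the defect kernel of `γt` is `frob / 2^{4P}`.**
[cite: BachLiebSolovej1994, eq. (2c.4)] -/
theorem frob_eq (σ : Fin 2) (a b : Fin (2 * (2 * r) + 1)) (T : Fin 2 → ℤ)
    (h0 : T 0 = (a : ℤ) - 2 * r) (h1 : T 1 = (b : ℤ) - 2 * r) :
    ∑ i, ∑ j, ‖defectKernel (box r) (c.γt σ) T i j‖ ^ 2 = ((c.frob σ a b : ℤ) : ℝ) / 2 ^ (4 * c.P) := by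
  have h4 : (2 : ℝ) ^ (4 * c.P) = (2 ^ (2 * c.P)) ^ 2 := by rw [← pow_mul]; ring_nf
  simp_rw [defectKernel_γt_apply, h0, h1, qEntry_eq_dEntry]
  rw [sum_site]
  simp_rw [sum_site (M := M) (fun q => ‖_‖ ^ 2)]
  unfold Cert.frob
  rw [sumSite_eq, Int.cast_sum, Finset.sum_div]
  refine Finset.sum_congr rfl fun x _ => ?_
  rw [sumSite_eq, Int.cast_sum, Finset.sum_div]
  refine Finset.sum_congr rfl fun y _ => ?_
  have hx : eM (eMinv x) = x := siteEquiv.apply_symm_apply x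
  have hy : eM (eMinv y) = y := siteEquiv.apply_symm_apply y
  rw [hx, hy, Complex.norm_ratCast, sq_abs]
  push_cast
  rw [h4, div_pow]

/-! ### §5 The defect bounds and the shrink parameters -/

/-- **The defect bound function** `c_σ(T) = C σ T / 2^{2P}` on the box of radius `2r`, zero outside.
[cite: BachLiebSolovej1994, eq. (2c.4)] -/
def Cert.cfun (σ : Fin 2) (T : Fin 2 → ℤ) : ℝ :=
  if h : (-(2 * r : ℤ) ≤ T 0 ∧ T 0 ≤ 2 * r) ∧ (-(2 * r : ℤ) ≤ T 1 ∧ T 1 ≤ 2 * r) then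
    (c.C σ ⟨(T 0 + 2 * r).toNat, by omega⟩ ⟨(T 1 + 2 * r).toNat, by omega⟩ : ℝ) / 2 ^ (2 * c.P)
  else 0

omit [∀ i, NeZero (M i)] in
/-- `cfun ≥ 0`. [cite: BachLiebSolovej1994, eq. (2c.4)] -/
theorem cfun_nonneg (σ : Fin 2) (T : Fin 2 → ℤ) : 0 ≤ c.cfun σ T := by
  unfold Cert.cfun; split_ifs <;> positivity

omit [∀ i, NeZero (M i)] in
/-- `cfun` at the table indices of radius `2r`. [cite: BachLiebSolovej1994, eq. (2c.4)] -/
theorem cfun_ivec (σ : Fin 2) (ab : Fin (2 * (2 * r) + 1) × Fin (2 * (2 * r) + 1)) :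
    c.cfun σ (ivec (2 * r) ab) = (c.C σ ab.1 ab.2 : ℝ) / 2 ^ (2 * c.P) := by
  unfold Cert.cfun
  simp only [ivec, Matrix.cons_val_zero, Matrix.cons_val_one]
  rw [dif_pos (by push_cast; omega)]
  congr 3 <;> exact Fin.ext (by simp)

/-- **Row checks give the Frobenius defect bounds on the whole defect support** (the rows `a < 2r`
through `d(-T) = d(T)ᴴ` and the symmetry of `C`). [cite: BachLiebSolovej1994, eq. (2c.4)] -/
theorem sqrt_frob_le_cfun (hS : c.checkSymm = true)
    (hrows : ∀ σ : Fin 2, ∀ a : Fin (2 * (2 * r) + 1), 2 * r ≤ a.val → c.rowCheck σ a = true)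
    (σ : Fin 2) {T : Fin 2 → ℤ} (hT : T ∈ defectSupport (box r)) :
    Real.sqrt (∑ i, ∑ j, ‖defectKernel (box r) (c.γt σ) T i j‖ ^ 2) ≤ c.cfun σ T := by
  obtain ⟨h0, h1⟩ := coord_of_mem_defectSupport hT
  have hS2 := hS
  rw [Cert.checkSymm, Bool.and_eq_true] at hS2
  have hCsymm := fun σ a b => of_decide_eq_true (of_allFin (of_allFin (of_allFin hS2.2 σ) a) b)
  -- the bound for a row `a ≥ 2r`
  have key : ∀ (T : Fin 2 → ℤ) (a b : Fin (2 * (2 * r) + 1)), T 0 = (a : ℤ) - 2 * r →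
      T 1 = (b : ℤ) - 2 * r → 2 * r ≤ a.val →
      Real.sqrt (∑ i, ∑ j, ‖defectKernel (box r) (c.γt σ) T i j‖ ^ 2) ≤
        (c.C σ a b : ℝ) / 2 ^ (2 * c.P) := by
    intro T a b hT0 hT1 ha
    have hrow : c.frob σ a b ≤ (c.C σ a b : ℤ) ^ 2 := of_decide_eq_true (of_allFin (hrows σ a ha) b)
    rw [frob_eq c σ a b T hT0 hT1]
    calc Real.sqrt (((c.frob σ a b : ℤ) : ℝ) / 2 ^ (4 * c.P))
        ≤ Real.sqrt (((c.C σ a b : ℝ)) ^ 2 / 2 ^ (4 * c.P)) := by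
          refine Real.sqrt_le_sqrt (div_le_div_of_nonneg_right ?_ (by positivity))
          exact_mod_cast hrow
      _ = (c.C σ a b : ℝ) / 2 ^ (2 * c.P) := by
          rw [show ((c.C σ a b : ℝ)) ^ 2 / 2 ^ (4 * c.P) = ((c.C σ a b : ℝ) / 2 ^ (2 * c.P)) ^ 2 by
            rw [div_pow, ← pow_mul]; ring_nf]
          exact Real.sqrt_sq (by positivity)
  set a : Fin (2 * (2 * r) + 1) := ⟨(T 0 + 2 * r).toNat, by omega⟩ with ha_def
  set b : Fin (2 * (2 * r) + 1) := ⟨(T 1 + 2 * r).toNat, by omega⟩ with hb_def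
  have hT0 : T 0 = (a : ℤ) - 2 * r := by simp only [a]; omega
  have hT1 : T 1 = (b : ℤ) - 2 * r := by simp only [b]; omega
  have hcf : c.cfun σ T = (c.C σ a b : ℝ) / 2 ^ (2 * c.P) := by
    unfold Cert.cfun; rw [dif_pos ⟨h0, h1⟩]
  rw [hcf]
  by_cases ha : 2 * r ≤ a.val
  · exact key T a b hT0 hT1 ha
  · -- go through `-T`
    set a' : Fin (2 * (2 * r) + 1) := ⟨4 * r - a.val, by omega⟩ with ha'_def
    set b' : Fin (2 * (2 * r) + 1) := ⟨4 * r - b.val, by omega⟩ with hb'_def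
    have hneg : defectKernel (box r) (c.γt σ) T = (defectKernel (box r) (c.γt σ) (-T))ᴴ := by
      rw [← defectKernel_neg (box r) (fun R hR => neg_mem_box hR) (c.γt σ) (fun R => γt_neg c hS σ R),
        neg_neg]
    rw [hneg, frobSq_conjTranspose]
    have hC : c.C σ a b = c.C σ a' b' := by
      rw [← hCsymm σ a' b']
      congr 1 <;> exact Fin.ext (by simp only [a', b']; omega)
    rw [hC]
    refine key (-T) a' b' ?_ ?_ (by simp only [a']; omega)
    · simp only [Pi.neg_apply, a']; push_cast [Nat.cast_sub (show a.val ≤ 4 * r by omega)]; omega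
    · simp only [Pi.neg_apply, b']; push_cast [Nat.cast_sub (show b.val ≤ 4 * r by omega)]; omega

omit [∀ i, NeZero (M i)] in
/-- **The total defect bound**: `Σ_{T ∈ S ∪ (S+S)} c_σ(T) ≤ Δ_σ / 2^{2P}`. [cite: BachLiebSolovej1994, eq. (2c.4)] -/
theorem sum_cfun_le (σ : Fin 2) :
    ∑ T ∈ defectSupport (box r), c.cfun σ T ≤ (c.Dl σ : ℝ) / 2 ^ (2 * c.P) := by
  have hsub : defectSupport (box r) ⊆ box (2 * r) := by
    intro T hT
    have h := coord_of_mem_defectSupport hT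
    rw [mem_box]; push_cast; exact h
  calc ∑ T ∈ defectSupport (box r), c.cfun σ T
      ≤ ∑ T ∈ box (2 * r), c.cfun σ T :=
        Finset.sum_le_sum_of_subset_of_nonneg hsub fun T _ _ => cfun_nonneg c σ T
    _ = ∑ ab : Fin (2 * (2 * r) + 1) × Fin (2 * (2 * r) + 1), (c.C σ ab.1 ab.2 : ℝ) / 2 ^ (2 * c.P) := by
        rw [sum_box]; exact Finset.sum_congr rfl fun ab _ => cfun_ivec c σ ab
    _ = (c.Dl σ : ℝ) / 2 ^ (2 * c.P) := by
        rw [Cert.Dl, sumFin_eq]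
        simp_rw [sumFin_eq]
        push_cast
        rw [Finset.sum_div, Fintype.sum_prod_type]
        exact Finset.sum_congr rfl fun a _ => by rw [Finset.sum_div]

omit [∀ i, NeZero (M i)] in
/-- **The shrink parameters satisfy the three inequalities identically.**
[cite: BachLiebSolovej1994, eq. (2c.4)] -/
theorem shrink_ineq (σ : Fin 2) :
    0 ≤ (c.A σ : ℝ) ∧ (c.A σ : ℝ) * (∑ T ∈ defectSupport (box r), c.cfun σ T) ≤ c.B σ ∧
      (c.A σ : ℝ) * (1 + ∑ T ∈ defectSupport (box r), c.cfun σ T) + c.B σ ≤ 1 := by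
  have hA : 0 ≤ (c.A σ : ℝ) := by unfold Cert.A; positivity
  have hsum := sum_cfun_le c σ
  have hB : (c.B σ : ℝ) = c.A σ * ((c.Dl σ : ℝ) / 2 ^ (2 * c.P)) := by
    unfold Cert.B; push_cast; ring
  have hone : (c.A σ : ℝ) * (1 + (c.Dl σ : ℝ) / 2 ^ (2 * c.P)) + c.B σ = 1 := by
    rw [hB]; unfold Cert.A; push_cast
    have h2 : (0 : ℝ) < 2 ^ (2 * c.P) := by positivity
    have hD : (0 : ℝ) ≤ c.Dl σ := by positivity
    field_simp
    ring
  refine ⟨hA, ?_, ?_⟩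
  · rw [hB]; exact mul_le_mul_of_nonneg_left hsum hA
  · calc (c.A σ : ℝ) * (1 + ∑ T ∈ defectSupport (box r), c.cfun σ T) + c.B σ
        ≤ (c.A σ : ℝ) * (1 + (c.Dl σ : ℝ) / 2 ^ (2 * c.P)) + c.B σ := by gcongr
      _ = 1 := hone

/-! ### §6 The shrunk kernel and its four numbers -/

/-- **Entries of the shrunk kernel are the rationals `gs`.** [cite: BachLiebSolovej1994, eq. (2c.4)] -/
theorem shrink_apply (σ : Fin 2) (R : Fin 2 → ℤ) (p q : RectTorusSite M) :
    shrinkKernel (c.γt σ) (c.A σ) (c.B σ) R p q = ((c.gs σ (R 0) (R 1) (eM p) (eM q) : ℚ) : ℂ) := by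
  have hR : R = 0 ↔ R 0 = 0 ∧ R 1 = 0 :=
    ⟨fun h => by simp [h], fun h => by funext i; fin_cases i <;> simp [h.1, h.2]⟩
  have hpq : eM p = eM q ↔ p = q := eM_injective.eq_iff
  rw [shrinkKernel, Matrix.add_apply, Matrix.smul_apply, γt_apply, Cert.gs, smul_eq_mul]
  by_cases h0 : R = 0
  · obtain ⟨h00, h01⟩ := hR.1 h0
    rw [if_pos h0, Matrix.smul_apply, Matrix.one_apply, smul_eq_mul]
    by_cases h' : p = q
    · rw [if_pos h', if_pos ⟨h00, h01, hpq.2 h'⟩]; push_cast; ring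
    · rw [if_neg h', if_neg fun h => h' (hpq.1 h.2.2)]; push_cast; ring
  · rw [if_neg h0, Matrix.zero_apply, if_neg fun h => h0 (hR.2 ⟨h.1, h.2.1⟩)]; push_cast; ring

/-- The real part of a rational complex number divided by the cell size. [folklore] -/
private theorem re_ratCast_div_card (x : ℚ) :
    ((x : ℂ)).re / Fintype.card (RectTorusSite M) = ((x / ((M 0 : ℚ) * M 1) : ℚ) : ℝ) := by
  rw [Complex.ratCast_re, card_site]; push_cast; rfl

/-- **The filling of the shrunk kernel is `nQ`.** [cite: BachLiebSolovej1994, eq. (2c.8)] -/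
theorem trace_shrink_re :
    (∑ σ, (shrinkKernel (c.γt σ) (c.A σ) (c.B σ) 0).trace).re / Fintype.card (RectTorusSite M) =
      (c.nQ : ℝ) := by
  have h : ∑ σ, (shrinkKernel (c.γt σ) (c.A σ) (c.B σ) 0).trace =
      ((∑ σ : Fin 2, ∑ x : Site M, c.gs σ 0 0 x x : ℚ) : ℂ) := by
    push_cast
    refine Finset.sum_congr rfl fun σ _ => ?_
    rw [Matrix.trace, sum_site]
    refine Finset.sum_congr rfl fun x _ => ?_
    rw [Matrix.diag_apply, shrink_apply]
    simp [show eM (eMinv x) = x from siteEquiv.apply_symm_apply x]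
  rw [h, re_ratCast_div_card, Cert.nQ, sumFin_eq]
  simp_rw [sumSite_eq]

/-- The bond and diagonal dictionary at a site. [folklore] -/
private theorem site_dict (p : RectTorusSite M) (x : Site M) (hx : eM p = x) :
    faceShift M 0 p 0 = fs₀ x ∧ faceShift M 0 p 1 = 0 ∧ faceShift M 1 p 0 = 0 ∧
      faceShift M 1 p 1 = fs₁ x ∧ eM (p + Pi.single 0 1) = wrap₀ x ∧ eM (p + Pi.single 1 1) = wrap₁ x ∧
      eM (p + Pi.single 0 1 + Pi.single 1 1) = wrap₁ (wrap₀ x) := by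
  subst hx
  exact ⟨(faceShift_zero_apply p).1, (faceShift_zero_apply p).2, (faceShift_one_apply p).1,
    (faceShift_one_apply p).2, eM_add_single_zero p, eM_add_single_one p, eM_add_single_zero_one p⟩

/-- **`K` of the shrunk kernel is `KQ`.** [cite: BachLiebSolovej1994, eq. (2c.8)] -/
theorem qfCellEnergy_one_zero_re :
    (qfCellEnergy 1 0 (fun σ => shrinkKernel (c.γt σ) (c.A σ) (c.B σ))).re /
        Fintype.card (RectTorusSite M) = (c.KQ : ℝ) := by
  have h : qfCellEnergy 1 0 (fun σ => shrinkKernel (c.γt σ) (c.A σ) (c.B σ)) =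
      ((-(∑ σ : Fin 2, ∑ x : Site M,
        ((c.gs σ (fs₀ x) 0 (wrap₀ x) x + c.gs σ (-fs₀ x) 0 x (wrap₀ x)) +
          (c.gs σ 0 (fs₁ x) (wrap₁ x) x + c.gs σ 0 (-fs₁ x) x (wrap₁ x)))) : ℚ) : ℂ) := by
    unfold qfCellEnergy
    push_cast
    simp only [neg_mul, one_mul, zero_mul, add_zero, neg_inj]
    refine Finset.sum_congr rfl fun σ _ => ?_
    rw [Fin.sum_univ_two, ← Finset.sum_add_distrib, sum_site]
    refine Finset.sum_congr rfl fun x _ => ?_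
    obtain ⟨e1, e2, e3, e4, e5, e6, -⟩ := site_dict (eMinv x) x (siteEquiv.apply_symm_apply x)
    simp only [shrink_apply, Pi.neg_apply, e1, e2, e3, e4, e5, e6, neg_zero,
      show eM (eMinv x) = x from siteEquiv.apply_symm_apply x]
  rw [h, re_ratCast_div_card, Cert.KQ, Cert.bondQ, sumFin_eq, neg_div, neg_div]
  simp_rw [sumSite_eq]

/-- **`K_d` of the shrunk kernel is `KdQ`.** [cite: BachLiebSolovej1994, eq. (2c.8)] -/
theorem qfCellDiag_re :
    (qfCellDiag (fun σ => shrinkKernel (c.γt σ) (c.A σ) (c.B σ))).re /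
        Fintype.card (RectTorusSite M) = (c.KdQ : ℝ) := by
  have h : qfCellDiag (fun σ => shrinkKernel (c.γt σ) (c.A σ) (c.B σ)) =
      ((∑ σ : Fin 2, ∑ x : Site M,
        (c.gs σ (fs₀ x) (fs₁ x) (wrap₁ (wrap₀ x)) x + c.gs σ (-fs₀ x) (-fs₁ x) x (wrap₁ (wrap₀ x)) +
          c.gs σ (fs₀ x) (-fs₁ x) (wrap₀ x) (wrap₁ x) + c.gs σ (-fs₀ x) (fs₁ x) (wrap₁ x) (wrap₀ x)) : ℚ) : ℂ) := by
    unfold qfCellDiag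
    push_cast
    refine Finset.sum_congr rfl fun σ _ => ?_
    rw [sum_site]
    refine Finset.sum_congr rfl fun x _ => ?_
    obtain ⟨e1, e2, e3, e4, e5, e6, e7⟩ := site_dict (eMinv x) x (siteEquiv.apply_symm_apply x)
    simp only [shrink_apply, Pi.neg_apply, Pi.add_apply, Pi.sub_apply, e1, e2, e3, e4, e5, e6, e7,
      neg_zero, add_zero, zero_add, sub_zero, zero_sub, neg_add_rev,
      show eM (eMinv x) = x from siteEquiv.apply_symm_apply x]
  rw [h, re_ratCast_div_card, Cert.KdQ, Cert.diagQ, sumFin_eq]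
  simp_rw [sumSite_eq]

/-- **`D` of the shrunk kernel is `DQ`.** [cite: BachLiebSolovej1994, eq. (2c.8)] -/
theorem qfCellEnergy_zero_one_re :
    (qfCellEnergy 0 1 (fun σ => shrinkKernel (c.γt σ) (c.A σ) (c.B σ))).re /
        Fintype.card (RectTorusSite M) = (c.DQ : ℝ) := by
  have h : qfCellEnergy 0 1 (fun σ => shrinkKernel (c.γt σ) (c.A σ) (c.B σ)) =
      ((∑ x : Site M, c.gs 0 0 0 x x * c.gs 1 0 0 x x : ℚ) : ℂ) := by
    unfold qfCellEnergy
    push_cast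
    simp only [neg_zero, zero_mul, one_mul, zero_add]
    rw [sum_site]
    refine Finset.sum_congr rfl fun x _ => ?_
    simp only [shrink_apply, Pi.zero_apply, show eM (eMinv x) = x from siteEquiv.apply_symm_apply x]
  rw [h, re_ratCast_div_card, Cert.DQ, sumSite_eq]

/-! ### §7 Soundness -/

/-- **SOUNDNESS OF THE KERNEL CHECKS.** For an integer certificate `c : QFK.Cert M r` whose
`checkBasic`, `checkSymm`, `checkNumbers` evaluate to `true` and whose defect rows `a ≥ 2r` pass
`rowCheck σ a` (each a `decide`), the shrunk kernel is an admissible translation-invariant quasi-free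
state of filling `c.n`, and `HartreeFock.energyDensityTT'_le_qfPlane` gives, for ALL real `t, t'`
and ALL `U ≥ 0`: `e(t, t', U; c.n) ≤ t·c.K - t'·c.Kd + U·c.D`.
[cite: BachLiebSolovej1994, eq. (2c.36)][cite: Lieb1981, Theorem] -/
theorem energyDensityTT'_le_plane_of_checks (hB : c.checkBasic = true) (hS : c.checkSymm = true)
    (hN : c.checkNumbers = true)
    (hrows : ∀ σ : Fin 2, ∀ a : Fin (2 * (2 * r) + 1), 2 * r ≤ a.val → c.rowCheck σ a = true)
    (t t' : ℝ) {U : ℝ} (hU : 0 ≤ U) :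
    ThermodynamicLimit.energyDensityTT' t t' U c.n ≤ t * c.K - t' * c.Kd + U * c.D := by
  have hB' := hB
  simp only [Cert.checkBasic, Bool.and_eq_true, decide_eq_true_eq] at hB'
  obtain ⟨⟨⟨hM0, hM1⟩, hn0⟩, hn2⟩ := hB'
  have hN' := hN
  simp only [Cert.checkNumbers, Bool.and_eq_true, decide_eq_true_eq] at hN'
  obtain ⟨⟨⟨hn, hK⟩, hKd⟩, hD⟩ := hN'
  have hM2 : ∀ i, 2 ≤ M i := fun i => by fin_cases i <;> assumption
  have hM0' : 1 ≤ M 0 := by omega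
  have hM1' : 1 ≤ M 1 := by omega
  have hk₀ : ∀ i, (![(r + 2) * M 1, (r + 2) * M 0] : Fin 2 → ℕ) i * M i = (r + 2) * M 0 * M 1 := by
    intro i; fin_cases i
    · show (r + 2) * M 1 * M 0 = (r + 2) * M 0 * M 1; ring
    · rfl
  have hRc : ∀ R ∈ box r, ∀ i, |R i| ≤ (((![r, r] : Fin 2 → ℕ) i : ℕ) : ℤ) := by
    intro R hR i; fin_cases i
    · exact abs_le_of_mem_box hR 0
    · exact abs_le_of_mem_box hR 1
  have hkRc : ∀ i, (![r, r] : Fin 2 → ℕ) i + 2 ≤ (![(r + 2) * M 1, (r + 2) * M 0] : Fin 2 → ℕ) i := by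
    intro i; fin_cases i
    · show r + 2 ≤ (r + 2) * M 1; nlinarith
    · show r + 2 ≤ (r + 2) * M 0; nlinarith
  refine energyDensityTT'_le_qfPlane hM2 ![(r + 2) * M 1, (r + 2) * M 0] ((r + 2) * M 0 * M 1)
    hk₀ (box r) ![r, r] hRc hkRc zero_mem_box (fun R hR => neg_mem_box hR)
    c.γt (fun σ R hR => γt_eq_zero c hR) (fun σ R => γt_neg c hS σ R) c.cfun
    (fun σ T hT => sqrt_frob_le_cfun c hS hrows σ hT) (fun σ => (c.A σ : ℝ)) (fun σ => (c.B σ : ℝ))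
    (fun σ => (shrink_ineq c σ).1) (fun σ => (shrink_ineq c σ).2.1) (fun σ => (shrink_ineq c σ).2.2)
    (by exact_mod_cast hn0) (by exact_mod_cast hn2) ?_ ?_ ?_ ?_ t t' hU
  · rw [trace_shrink_re, hn]
  · rw [qfCellEnergy_one_zero_re, hK]
  · rw [qfCellDiag_re, hKd]
  · rw [qfCellEnergy_zero_one_re, hD]

omit [∀ i, NeZero (M i)] in
/-- Assembling the row checks downwards: from the row `k` and all rows `≥ k + 1` to all rows `≥ k`
(the certificate files prove one row per `decide` and chain them with this).
[cite: Neumaier2004CompleteSearch, §11] -/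
theorem rows_from_succ {σ : Fin 2} {k : ℕ} (hk : k < 2 * (2 * r) + 1)
    (hrow : c.rowCheck σ ⟨k, hk⟩ = true)
    (hrest : ∀ a : Fin (2 * (2 * r) + 1), k + 1 ≤ a.val → c.rowCheck σ a = true) :
    ∀ a : Fin (2 * (2 * r) + 1), k ≤ a.val → c.rowCheck σ a = true := by
  intro a ha
  rcases Nat.eq_or_lt_of_le ha with h | h
  · have : a = ⟨k, hk⟩ := Fin.ext h.symm
    rw [this]; exact hrow
  · exact hrest a h

omit [∀ i, NeZero (M i)] in
/-- The vacuous top of the row chain. [cite: Neumaier2004CompleteSearch, §11] -/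
theorem rows_from_top {σ : Fin 2} :
    ∀ a : Fin (2 * (2 * r) + 1), 2 * (2 * r) + 1 ≤ a.val → c.rowCheck σ a = true :=
  fun a ha => absurd a.isLt (by omega)

omit [∀ i, NeZero (M i)] in
/-- Both spins from the two spin chains. [cite: Neumaier2004CompleteSearch, §11] -/
theorem rows_of_spins
    (h0 : ∀ a : Fin (2 * (2 * r) + 1), 2 * r ≤ a.val → c.rowCheck 0 a = true)
    (h1 : ∀ a : Fin (2 * (2 * r) + 1), 2 * r ≤ a.val → c.rowCheck 1 a = true) :
    ∀ σ : Fin 2, ∀ a : Fin (2 * (2 * r) + 1), 2 * r ≤ a.val → c.rowCheck σ a = true := by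
  intro σ; fin_cases σ
  · exact h0
  · exact h1

/-- **Consumer form on a parameter box.** Under the checks, if moreover `0 ≤ c.D`, then for all
`t' ∈ ℝ` and all `U ∈ [0, U₂]`: `e(1, t', U; c.n) ≤ c.K - t'·c.Kd + U₂·c.D` (the plane is
nondecreasing in `U`). [cite: BachLiebSolovej1994, eq. (2c.36)] -/
theorem energyDensityTT'_le_of_checks_U_le (hB : c.checkBasic = true) (hS : c.checkSymm = true)
    (hN : c.checkNumbers = true)
    (hrows : ∀ σ : Fin 2, ∀ a : Fin (2 * (2 * r) + 1), 2 * r ≤ a.val → c.rowCheck σ a = true)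
    (hD : 0 ≤ c.D) (t' : ℝ) {U U₂ : ℝ} (hU : 0 ≤ U) (hU₂ : U ≤ U₂) :
    ThermodynamicLimit.energyDensityTT' 1 t' U c.n ≤ c.K - t' * c.Kd + U₂ * c.D := by
  have h := energyDensityTT'_le_plane_of_checks c hB hS hN hrows 1 t' hU
  have hD' : (0 : ℝ) ≤ c.D := by exact_mod_cast hD
  nlinarith

end QFK

end HartreeFock

end Literature.MathematicalPhysics.QuantumLattice
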